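import Literature.Algebra.Homology.RepExtGroupCohomology
import Literature.Algebra.Homology.ExtOfProjectiveResolutionNaturality
import HarnessLib

/-!
# Naturality in the coefficients of `Extⁿ_{Rep k G}(k, A) ≃+ Hⁿ(G, A)`

Topic `Algebra/Homology`; namespace `Literature.Algebra.Homology.RepExt`.  Theorems only (and no new
definition); no named fact, no instance, no `sorry`.  Sequel of `RepExtGroupCohomology` (door-c4 g14:
`extTrivialAddEquivGroupCohomology A n : Ext (Rep.trivial k G k) A n ≃+ groupCohomology A n`) and of
`ExtOfProjectiveResolutionNaturality` (naturality of the first-variable engine in the second variable),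
using the tree's `ResolutionComparison.resolutionIso_hom_naturality` (door of
`GroupCohomologyResolutionComparison`: Mathlib's `groupCohomologyIso` made natural in `A`).

* `addEquiv₀_comp_mk₀` (bookkeeping), `homComplexIso_naturality`, `homComplexHomologyIso_hom_naturality`
  (the identification `Ext⁰(P•, A) ≅ Hom(P•, A)` and its homology version commute with
  post-composition by `f : A ⟶ B`, i.e. with `ResolutionComparison.postcomp`);
* `extTrivialAddEquivHomComplexHomology_naturality`, `extTrivialAddEquivResolutionHomology_naturality`;
* **`extTrivialAddEquivGroupCohomology_naturality`**: for `f : A ⟶ B` in `Rep k G` and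
  `x ∈ Extⁿ(k, A)`, `E_B (x ∘ f) = Hⁿ(G, f) (E_A x)` with `Hⁿ(G, f) = groupCohomology.map (MonoidHom.id G) f n`
  (Brown, *Cohomology of Groups*, III §1: `H*(G, –)` as a functor is `Ext*_{ℤG}(ℤ, –)`);
  `extTrivialAddEquivGroupCohomology_symm_naturality` (the inverse direction).

Written for the Poitou–Tate programme of crux `stmt-BirchSwinnertonDyer-19295` (cell
`bsd-schneider-ideate`, seat door-c4 gen 14): transports statements about `groupCohomology.map` in the
coefficients (directed unions `ResolutionComparison.exists_map_eq_of_directed`, maps induced by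
inclusions of submodules, Tate–Nakayama maps) to Mathlib's derived-category `Ext`.
HONEST FRAMING: homological algebra only.

## References
* K. S. Brown, *Cohomology of Groups*, GTM 87 (1982), III §1. [Brown1982CohomologyGroups]
* C. A. Weibel, *An introduction to homological algebra* (1994), §2.5, Thm. 2.7.6. [Weibel1994]
-/

noncomputable section

universe u

namespace Literature.Algebra.Homology

namespace RepExt

open CategoryTheory CategoryTheory.Limits CategoryTheory.Abelian

variable {k G : Type u} [CommRing k] [Group G]

/-! ## §1 `Ext⁰(P•, A) ≅ Hom(P•, A)` is natural in `A` -/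

section HomComplex

variable (P : ChainComplex (Rep.{u} k G) ℕ) {A B : Rep.{u} k G} (f : A ⟶ B)

/-- `Ext⁰`-bookkeeping in `Rep k G`: `addEquiv₀ (x ∘ mk₀ f) = addEquiv₀ x ≫ f`. [cite: Weibel1994, §2.7] -/
theorem addEquiv₀_comp_mk₀ {X : Rep.{u} k G} (x : Ext X A 0) :
    Ext.addEquiv₀ (x.comp (Ext.mk₀ f) (add_zero 0)) = Ext.addEquiv₀ x ≫ f := by
  apply Ext.addEquiv₀.symm.injective
  rw [AddEquiv.symm_apply_apply, Ext.addEquiv₀_symm_apply, ← Ext.mk₀_comp_mk₀,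
    Ext.mk₀_addEquiv₀_apply]

/-- **`homComplexIso` is natural in the coefficients**: post-composition on `Ext⁰(P•, –)`
(`LeftResolution.homComplexMap`) corresponds to `ResolutionComparison.postcomp` on `Hom(P•, –)`.
[cite: Brown1982CohomologyGroups, III §1] -/
theorem homComplexIso_naturality :
    LeftResolution.homComplexMap P f ≫ (homComplexIso P B).hom =
      (homComplexIso P A).hom ≫
        ((forgetAb k).mapHomologicalComplex (ComplexShape.up ℕ)).map
          (ResolutionComparison.postcomp P f) := by
  ext n x
  change Ext.addEquiv₀ (x.comp (Ext.mk₀ f) (add_zero 0)) =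
    (forgetAb k).map ((ResolutionComparison.postcomp P f).f n) (Ext.addEquiv₀ x)
  rw [addEquiv₀_comp_mk₀]
  rfl

/-- **`homComplexHomologyIso` is natural in the coefficients.** [cite: Brown1982CohomologyGroups, III §1] -/
theorem homComplexHomologyIso_hom_naturality (n : ℕ) :
    HomologicalComplex.homologyMap (LeftResolution.homComplexMap P f) n ≫
        (homComplexHomologyIso P B n).hom =
      (homComplexHomologyIso P A n).hom ≫
        (forgetAb k).map (HomologicalComplex.homologyMap (ResolutionComparison.postcomp P f) n) := by
  have h1 : HomologicalComplex.homologyMap (LeftResolution.homComplexMap P f) n ≫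
      ((HomologicalComplex.homologyFunctor _ _ n).mapIso (homComplexIso P B)).hom =
      ((HomologicalComplex.homologyFunctor _ _ n).mapIso (homComplexIso P A)).hom ≫
        HomologicalComplex.homologyMap
          (((forgetAb k).mapHomologicalComplex (ComplexShape.up ℕ)).map
            (ResolutionComparison.postcomp P f)) n := by
    change HomologicalComplex.homologyMap _ n ≫ HomologicalComplex.homologyMap _ n =
      HomologicalComplex.homologyMap _ n ≫ HomologicalComplex.homologyMap _ n
    rw [← HomologicalComplex.homologyMap_comp, ← HomologicalComplex.homologyMap_comp,
      homComplexIso_naturality]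
  have h2 : HomologicalComplex.homologyMap
      (((forgetAb k).mapHomologicalComplex (ComplexShape.up ℕ)).map
        (ResolutionComparison.postcomp P f)) n ≫
      (((P.linearYonedaObj k B).sc n).mapHomologyIso (forgetAb k)).hom =
      (((P.linearYonedaObj k A).sc n).mapHomologyIso (forgetAb k)).hom ≫
        (forgetAb k).map (HomologicalComplex.homologyMap (ResolutionComparison.postcomp P f) n) :=
    ShortComplex.mapHomologyIso_hom_naturality
      ((HomologicalComplex.shortComplexFunctor _ _ n).map (ResolutionComparison.postcomp P f))
      (forgetAb k)
  change _ ≫ (_ ≫ _) = (_ ≫ _) ≫ _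
  exact ((Category.assoc _ _ _).symm.trans (eq_whisker h1 _)).trans
    ((Category.assoc _ _ _).trans ((whisker_eq _ h2).trans (Category.assoc _ _ _).symm))

end HomComplex

/-! ## §2 Naturality of `Extⁿ(k, A) ≃+ Hⁿ(Hom(P•, A))` -/

section Resolution

variable (P : ProjectiveResolution (Rep.trivial k G k)) {A B : Rep.{u} k G} (f : A ⟶ B)

/-- The engine isomorphism `Extⁿ(k, A) ≃+ Hⁿ(Ext⁰(P•, A))` is natural in `A`.
[cite: Weibel1994, Theorem 2.7.6] -/
theorem extTrivialAddEquivHomComplexHomology_naturality (n : ℕ) (x : Ext (Rep.trivial k G k) A n) :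
    extTrivialAddEquivHomComplexHomology P B n (x.comp (Ext.mk₀ f) (add_zero n)) =
      (HomologicalComplex.homologyMap (LeftResolution.homComplexMap P.complex f) n).hom
        (extTrivialAddEquivHomComplexHomology P A n x) := by
  haveI := epi_aug P
  cases n with
  | zero =>
    exact (LeftResolution.extAddEquivHomologyZero_naturality P.complex f (aug P) (d_comp_aug P)
      (exact_aug P) x).symm
  | succ n =>
    exact (LeftResolution.extAddEquivHomologySucc_naturality P.complex f (aug P) (d_comp_aug P)
      (exact_aug P) P.complex_exactAt_succ
      (LeftResolution.ext_eq_zero_of_projective P.complex A P.projective)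
      (LeftResolution.ext_eq_zero_of_projective P.complex B P.projective) n x).symm

/-- **`Extⁿ(k, A) ≃+ Hⁿ(Hom(P•, A))` is natural in `A`** (post-composition versus
`ResolutionComparison.postcomp`). [cite: Brown1982CohomologyGroups, III §1][cite: Weibel1994, Theorem 2.7.6] -/
theorem extTrivialAddEquivResolutionHomology_naturality (n : ℕ) (x : Ext (Rep.trivial k G k) A n) :
    extTrivialAddEquivResolutionHomology P B n (x.comp (Ext.mk₀ f) (add_zero n)) =
      (HomologicalComplex.homologyMap (ResolutionComparison.postcomp P.complex f) n).hom
        (extTrivialAddEquivResolutionHomology P A n x) := by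
  change (homComplexHomologyIso P.complex B n).hom.hom
      (extTrivialAddEquivHomComplexHomology P B n (x.comp (Ext.mk₀ f) (add_zero n))) =
    ((forgetAb k).map (HomologicalComplex.homologyMap (ResolutionComparison.postcomp P.complex f) n)).hom
      ((homComplexHomologyIso P.complex A n).hom.hom (extTrivialAddEquivHomComplexHomology P A n x))
  rw [extTrivialAddEquivHomComplexHomology_naturality]
  change (HomologicalComplex.homologyMap (LeftResolution.homComplexMap P.complex f) n ≫
      (homComplexHomologyIso P.complex B n).hom).hom _ =
    ((homComplexHomologyIso P.complex A n).hom ≫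
      (forgetAb k).map (HomologicalComplex.homologyMap (ResolutionComparison.postcomp P.complex f) n)).hom _
  rw [homComplexHomologyIso_hom_naturality]

end Resolution

/-! ## §3 Naturality of `Extⁿ(k, A) ≃+ Hⁿ(G, A)` -/

/-- **`Extⁿ_{Rep k G}(k, A) ≃+ Hⁿ(G, A)` is natural in `A`**: `E_B (x ∘ f) = Hⁿ(G, f) (E_A x)` with
`Hⁿ(G, f) = groupCohomology.map (MonoidHom.id G) f n`. [cite: Brown1982CohomologyGroups, III §1] -/
theorem extTrivialAddEquivGroupCohomology_naturality {A B : Rep.{u} k G} (f : A ⟶ B) (n : ℕ)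
    (x : Ext (Rep.trivial k G k) A n) :
    extTrivialAddEquivGroupCohomology B n (x.comp (Ext.mk₀ f) (add_zero n)) =
      (groupCohomology.map (MonoidHom.id G) f n).hom (extTrivialAddEquivGroupCohomology A n x) := by
  -- `E_G = R⁻¹ ∘ E_res` with `R = resolutionIso` (forgotten to abelian groups)
  set P := Rep.standardResolution k G with hP
  have hnat := ResolutionComparison.resolutionIso_hom_naturality P f n
  -- evaluate the naturality square of `resolutionIso` at the element `E_G^A x`
  have key : (HomologicalComplex.homologyMap (ResolutionComparison.postcomp P.complex f) n).hom
      ((ResolutionComparison.resolutionIso P A n).hom.hom (extTrivialAddEquivGroupCohomology A n x)) =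
      (ResolutionComparison.resolutionIso P B n).hom.hom
        ((groupCohomology.map (MonoidHom.id G) f n).hom (extTrivialAddEquivGroupCohomology A n x)) := by
    change ((ResolutionComparison.resolutionIso P A n).hom ≫
        HomologicalComplex.homologyMap (ResolutionComparison.postcomp P.complex f) n).hom _ =
      (groupCohomology.map (MonoidHom.id G) f n ≫ (ResolutionComparison.resolutionIso P B n).hom).hom _
    rw [hnat]
  -- `R_A (E_G^A x) = E_res^A x`
  have hA : (ResolutionComparison.resolutionIso P A n).hom.hom (extTrivialAddEquivGroupCohomology A n x) =
      extTrivialAddEquivResolutionHomology P A n x := by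
    change ((forgetAb k).mapIso (ResolutionComparison.resolutionIso P A n)).addCommGroupIsoToAddEquiv
        (((forgetAb k).mapIso (ResolutionComparison.resolutionIso P A n)).addCommGroupIsoToAddEquiv.symm
          (extTrivialAddEquivResolutionHomology P A n x)) = _
    rw [AddEquiv.apply_symm_apply]
  apply ((forgetAb k).mapIso (ResolutionComparison.resolutionIso P B n)).addCommGroupIsoToAddEquiv.injective
  change ((forgetAb k).mapIso (ResolutionComparison.resolutionIso P B n)).addCommGroupIsoToAddEquiv
      (((forgetAb k).mapIso (ResolutionComparison.resolutionIso P B n)).addCommGroupIsoToAddEquiv.symm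
        (extTrivialAddEquivResolutionHomology P B n (x.comp (Ext.mk₀ f) (add_zero n)))) =
    (ResolutionComparison.resolutionIso P B n).hom.hom
      ((groupCohomology.map (MonoidHom.id G) f n).hom (extTrivialAddEquivGroupCohomology A n x))
  rw [AddEquiv.apply_symm_apply, extTrivialAddEquivResolutionHomology_naturality, ← hA, key]

/-- The same naturality for the inverse: `E_B⁻¹ (Hⁿ(G, f) y) = E_A⁻¹ y ∘ f`.
[cite: Brown1982CohomologyGroups, III §1] -/
theorem extTrivialAddEquivGroupCohomology_symm_naturality {A B : Rep.{u} k G} (f : A ⟶ B) (n : ℕ)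
    (y : groupCohomology A n) :
    (extTrivialAddEquivGroupCohomology B n).symm ((groupCohomology.map (MonoidHom.id G) f n).hom y) =
      ((extTrivialAddEquivGroupCohomology A n).symm y).comp (Ext.mk₀ f) (add_zero n) := by
  apply (extTrivialAddEquivGroupCohomology B n).injective
  rw [AddEquiv.apply_symm_apply, extTrivialAddEquivGroupCohomology_naturality, AddEquiv.apply_symm_apply]

end RepExt

end Literature.Algebra.Homology
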